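import Mathlib
import Summits.Schanuel.Schanuel.Theorems.RigidCoreMinimalCounterexampleInAclNoFullLine

/-!
# Projected fibre finiteness along a line of mates — crux stmt-Schanuel-0969 `RigidCore.MinimalCounterexampleInAcl`

Line `kernel-arithmetic-selection` (lead prover-line-stmt-Schanuel-0969-c13-0), registered stub `stub_lineFamily_projFibreFinite`
(`--supports stmt-Schanuel-0969`): the helper of (P2) `stub_corankGeTwo_noFullLine_curveCase` (S7b in the CURVE CASE, obstruction
note `Cruxes/MinimalCounterexampleInAcl/Lines/kernel_arithmetic_selection_S7b_obstruction.md` §4).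

Let `x` be a first failure of rank `n` with `r` log coordinates, `μ ≠ 0` an integer direction supported on the log indices, and
`xm : J → mates of x` (`J ⊆ ℤ` infinite) a family ON THE `μ`-LINE (`xm j` has log part `(x_i + 2πijμ_i)_{i<r}`).  Suppose that over a
field of constants `K = ℚ(ev)` the slice points `P_j = (xm j, e^{xm j})` are MUTUALLY GENERIC with `P_{j₀}` (the same `ℚ`-relations in
`(ev, ·)`, hence the same `K`-relations, `mem_kLocus_adjoin_of_relations`) and `P_{j₀}` is algebraic over `ℚ[ev, v]`, `v = xm j₀ k₀` the
moving coordinate (`μ_{k₀} ≠ 0`).  Then some PURE coordinate `x_i` (`i ≥ r`) has `j ↦ e^{xm j i}` finite-to-one on `J`: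

1. some pure `e^{xm j₀ i}` is transcendental over `K` — otherwise every pure exponential of every `P_j` is a root of the transferred
   minimal relation, the exponential vectors of the family take finitely many values, and kernel classes of mates are finite
   (`locusMates_cexp_fibre_finite`), so `J` would be finite (`j ↦ xm j k₀ = x_{k₀} + 2πijμ_{k₀}` is injective);
2. for that `i`, `t = e^{xm j₀ i}` is algebraic over `K[v]`: `Σ_m g_m(v) t^m = 0` with `g_m ∈ K[V]` not all zero; the relation
   transfers to every `P_j`, and so does transcendence of `e^{xm j i}` over `K` (genericity is symmetric); on the fibre `e^{xm j i} = ω`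
   the polynomial `R_ω(V) = Σ_m ω^m g_m(V) ∈ ℂ[V]` is non-zero (a coefficient is a non-zero `K`-polynomial evaluated at the
   transcendental `ω`) and vanishes at the distinct `v_j = xm j k₀`, which are therefore finitely many.

References: status note `Cruxes/MinimalCounterexampleInAcl/Lines/kernel_arithmetic_selection.md` §Addendum c13.
-/

noncomputable section

set_option linter.dupNamespace false

open Complex Set

namespace Summit.Schanuel.Schanuel.Cruxes.MinimalCounterexampleInAcl.KernelArithmeticSelection

/-- Evaluating a one-variable `K`-polynomial placed on the coordinate `s` of an `MvPolynomial`. [folklore] -/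
theorem aeval_polynomial_aeval_X {σ K : Type} [Field K] [Algebra K ℂ] (z : σ → ℂ) (s : σ) (q : Polynomial K) :
    MvPolynomial.aeval z (Polynomial.aeval (MvPolynomial.X s : MvPolynomial σ K) q) = Polynomial.aeval (z s) q := by
  rw [← Polynomial.aeval_algHom_apply, MvPolynomial.aeval_X]

/-- **Stub P2-helper — PROJECTED FIBRE FINITENESS ALONG A LINE OF MATES (PROVED).**  For an infinite family of mates on the
`μ`-line whose slice points are, over a field of constants `ℚ(ev)`, algebraic over `ℚ[ev, xm j₀ k₀]` and mutually generic, some pure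
coordinate `x_i` has `j ↦ e^{xm j i}` finite-to-one along the family (see the module docstring). [folklore] -/
theorem stub_lineFamily_projFibreFinite : ∀ (n r : ℕ), 3 ≤ n → r + 2 ≤ n → ∀ (x : Fin n → ℂ), x ∈ Summit.Schanuel.Schanuel.Cruxes.MinimalCounterexampleInAcl.KernelArithmeticSelection.firstFailures n → (∀ i : Fin n, (i : ℕ) < r → IsAlgebraic ℚ (Complex.exp (x i))) → (∀ M : Fin n → ℤ, (∃ i : Fin n, r ≤ (i : ℕ) ∧ M i ≠ 0) → Transcendental ℚ (Complex.exp (∑ i, (M i : ℂ) * x i))) → ∀ μ : Fin n → ℤ, (∀ i : Fin n, r ≤ (i : ℕ) → μ i = 0) → μ ≠ 0 → ∀ (J : Set ℤ) (xm : ℤ → Fin n → ℂ), (∀ j ∈ J, xm j ∈ Summit.Schanuel.Schanuel.Cruxes.MinimalCounterexampleInAcl.KernelArithmeticSelection.locusMates x ∧ ∀ i : Fin n, (i : ℕ) < r → xm j i = x i + 2 * ↑Real.pi * Complex.I * ((j • μ) i : ℂ)) → J.Infinite → (∃ (ι : Type) (ev : ι → ℂ) (j₀ : ℤ) (k₀ :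 Fin n), j₀ ∈ J ∧ μ k₀ ≠ 0 ∧ (∀ z ∈ Set.range (xm j₀) ∪ Set.range (Complex.exp ∘ xm j₀), IsAlgebraic ↥(Algebra.adjoin ℚ (Set.range ev ∪ {xm j₀ k₀})) z) ∧ ∀ j ∈ J, ∀ H : MvPolynomial (ι ⊕ (Fin n ⊕ Fin n)) ℚ, MvPolynomial.aeval (Sum.elim ev (Sum.elim (xm j₀) (Complex.exp ∘ xm j₀))) H = 0 ↔ MvPolynomial.aeval (Sum.elim ev (Sum.elim (xm j) (Complex.exp ∘ xm j))) H = 0) → ∃ i : Fin n, r ≤ (i : ℕ) ∧ ∀ ω : ℂ, Set.Finite {j : ℤ | j ∈ J ∧ Complex.exp (xm j i) = ω} := by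
  rintro n r - - x hx - - μ hμsupp - J xm hfam hJinf ⟨ι, ev, j₀, k₀, hj₀, hk₀, hH1, hH2⟩
  classical
  set K : IntermediateField ℚ ℂ := IntermediateField.adjoin ℚ (Set.range ev) with hK
  set Pt : ℤ → (Fin n ⊕ Fin n → ℂ) := fun j => Sum.elim (xm j) (cexp ∘ xm j) with hPt
  have h2πi : (2 * ↑Real.pi * I : ℂ) ≠ 0 := by simp [Real.pi_ne_zero, I_ne_zero]
  -- ### the frame of the line
  have hk₀r : (k₀ : ℕ) < r := by
    by_contra h
    exact hk₀ (hμsupp k₀ (not_lt.1 h))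
  have hxmk : ∀ j ∈ J, xm j k₀ = x k₀ + 2 * ↑Real.pi * I * ((j : ℂ) * (μ k₀ : ℂ)) := by
    intro j hj
    rw [(hfam j hj).2 k₀ hk₀r, Pi.smul_apply, smul_eq_mul]
    push_cast; ring
  have hinj : Set.InjOn (fun j => xm j k₀) J := by
    intro j hj j' hj' h
    have h' : xm j k₀ = xm j' k₀ := h
    rw [hxmk j hj, hxmk j' hj', add_right_inj] at h'
    have hd : (μ k₀ : ℂ) ≠ 0 := by exact_mod_cast hk₀
    have h3 : (j : ℂ) = j' := mul_right_cancel₀ hd (mul_left_cancel₀ h2πi h')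
    exact_mod_cast h3
  have hinjxm : Set.InjOn xm J := fun j hj j' hj' h => hinj hj hj' (congrFun h k₀)
  have hexplog : ∀ j ∈ J, ∀ i : Fin n, (i : ℕ) < r → cexp (xm j i) = cexp (x i) := by
    intro j hj i hi
    rw [(hfam j hj).2 i hi, Pi.smul_apply, smul_eq_mul, Complex.exp_add]
    have h1 : cexp (2 * ↑Real.pi * I * ((j * μ i : ℤ) : ℂ)) = 1 := by
      rw [show (2 * ↑Real.pi * I * ((j * μ i : ℤ) : ℂ)) = ((j * μ i : ℤ) : ℂ) * (2 * ↑Real.pi * I) by ring]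
      exact Complex.exp_int_mul_two_pi_mul_I (j * μ i)
    rw [h1, mul_one]
  -- ### transfer of `K`-relations in both directions (mutual genericity)
  have hKrel : ∀ j ∈ J, ∀ G : MvPolynomial (Fin n ⊕ Fin n) K,
      MvPolynomial.aeval (Pt j₀) G = 0 → MvPolynomial.aeval (Pt j) G = 0 := fun j hj =>
    mem_kLocus_iff.1 (mem_kLocus_adjoin_of_relations ev fun H hH => (hH2 j hj H).1 hH)
  have hKrel' : ∀ j ∈ J, ∀ G : MvPolynomial (Fin n ⊕ Fin n) K,
      MvPolynomial.aeval (Pt j) G = 0 → MvPolynomial.aeval (Pt j₀) G = 0 := fun j hj =>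
    mem_kLocus_iff.1 (mem_kLocus_adjoin_of_relations ev fun H hH => (hH2 j hj H).2 hH)
  -- kernel classes: each exponential fibre of the family is finite
  have hpiece : ∀ y : Fin n → ℂ, Set.Finite {j : ℤ | j ∈ J ∧ cexp ∘ xm j = y} := by
    intro y
    refine Set.Finite.of_finite_image ((locusMates_cexp_fibre_finite hx y).subset ?_)
      (hinjxm.mono fun j hj => hj.1)
    rintro _ ⟨j, ⟨hj, hjy⟩, rfl⟩
    exact ⟨(hfam j hj).1, hjy⟩
  -- ### (1) some pure exponential of `P_{j₀}` is transcendental over `K`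
  have hexA : ∃ i : Fin n, r ≤ (i : ℕ) ∧ Transcendental K (cexp (xm j₀ i)) := by
    by_contra hno
    have halg : ∀ i : Fin n, r ≤ (i : ℕ) → ∃ p : Polynomial K, p ≠ 0 ∧ Polynomial.aeval (cexp (xm j₀ i)) p = 0 := by
      intro i hi
      by_contra h
      exact hno ⟨i, hi, fun ⟨p, hp0, hpz⟩ => h ⟨p, hp0, hpz⟩⟩
    choose! p hp0 hpz using halg
    set F : Fin n → Set ℂ := fun i => if (i : ℕ) < r then {cexp (x i)}
      else (((p i).map (algebraMap K ℂ)).roots.toFinset : Set ℂ) with hF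
    have hFfin : ∀ i, (F i).Finite := by
      intro i
      simp only [hF]
      split_ifs
      · exact Set.finite_singleton _
      · exact Finset.finite_toSet _
    have hS : Set.Finite {y : Fin n → ℂ | ∀ i, y i ∈ F i} := Set.Finite.pi' hFfin
    refine hJinf ((hS.biUnion fun y _ => hpiece y).subset fun j hj => ?_)
    refine Set.mem_biUnion (x := cexp ∘ xm j) ?_ ⟨hj, rfl⟩
    intro i
    by_cases hi : (i : ℕ) < r
    · simp only [hF, if_pos hi, Function.comp_apply, Set.mem_singleton_iff]
      exact hexplog j hj i hi
    · have hi' : r ≤ (i : ℕ) := not_lt.1 hi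
      simp only [hF, if_neg hi, Function.comp_apply, Finset.mem_coe, Multiset.mem_toFinset]
      rw [Polynomial.mem_roots (Polynomial.map_ne_zero (hp0 i hi')), Polynomial.IsRoot.def, Polynomial.eval_map,
        ← Polynomial.aeval_def]
      have h := hKrel j hj (Polynomial.aeval (MvPolynomial.X (Sum.inr i)) (p i))
        (by rw [aeval_polynomial_aeval_X]; exact hpz i hi')
      rw [aeval_polynomial_aeval_X] at h
      exact h
  obtain ⟨i, hir, htr⟩ := hexA
  refine ⟨i, hir, fun ω => ?_⟩
  -- ### (2) the bivariate `K`-relation between `e^{x_i}` and the moving coordinate `v = x_{k₀}`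
  set v₀ : ℂ := xm j₀ k₀ with hv₀
  have halgt : IsAlgebraic (Algebra.adjoin ℚ (Set.range ev ∪ {v₀})) (cexp (xm j₀ i)) :=
    hH1 _ (Or.inr ⟨i, rfl⟩)
  obtain ⟨f, hf0, hft⟩ : ∃ f : Polynomial (Algebra.adjoin K ({v₀} : Set ℂ)), f ≠ 0 ∧
      Polynomial.aeval (cexp (xm j₀ i)) f = 0 := isAlgebraic_adjoin_adjoin_of_isAlgebraic_adjoin ev halgt
  have hcoef : ∀ m : ℕ, ∃ g : Polynomial K, Polynomial.aeval v₀ g = ((f.coeff m : Algebra.adjoin K ({v₀} : Set ℂ)) : ℂ) := by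
    intro m
    exact (AlgHom.mem_range _).1 ((Algebra.adjoin_singleton_eq_range_aeval K v₀).le (f.coeff m).2)
  choose g hg using hcoef
  set G : MvPolynomial (Fin n ⊕ Fin n) K :=
    ∑ m ∈ f.support, Polynomial.aeval (MvPolynomial.X (Sum.inl k₀)) (g m) * MvPolynomial.X (Sum.inr i) ^ m with hG
  have hGj₀ : MvPolynomial.aeval (Pt j₀) G = 0 := by
    rw [← hft, Polynomial.aeval_def, Polynomial.eval₂_eq_sum, Polynomial.sum_def, hG, map_sum]
    refine Finset.sum_congr rfl fun m _ => ?_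
    rw [map_mul, map_pow, aeval_polynomial_aeval_X, MvPolynomial.aeval_X]
    show Polynomial.aeval (xm j₀ k₀) (g m) * cexp (xm j₀ i) ^ m = _
    rw [hg m]
    rfl
  have hGj : ∀ j ∈ J, ∑ m ∈ f.support, Polynomial.aeval (xm j k₀) (g m) * cexp (xm j i) ^ m = 0 := by
    intro j hj
    have h := hKrel j hj G hGj₀
    rw [hG, map_sum] at h
    rw [← h]
    refine Finset.sum_congr rfl fun m _ => ?_
    rw [map_mul, map_pow, aeval_polynomial_aeval_X, MvPolynomial.aeval_X]
    rfl
  -- transcendence of `e^{xm j i}` over `K` transfers along the family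
  have htrj : ∀ j ∈ J, Transcendental K (cexp (xm j i)) := by
    intro j hj halgj
    obtain ⟨q, hq0, hqz⟩ : ∃ q : Polynomial K, q ≠ 0 ∧ Polynomial.aeval (cexp (xm j i)) q = 0 := halgj
    refine htr ⟨q, hq0, ?_⟩
    have h := hKrel' j hj (Polynomial.aeval (MvPolynomial.X (Sum.inr i)) q)
      (by rw [aeval_polynomial_aeval_X]; exact hqz)
    rw [aeval_polynomial_aeval_X] at h
    exact h
  -- ### (3) the fibre over `ω`
  by_cases hne : Set.Nonempty {j : ℤ | j ∈ J ∧ cexp (xm j i) = ω}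
  swap
  · rw [Set.not_nonempty_iff_eq_empty.1 hne]
    exact Set.finite_empty
  obtain ⟨j₁, hj₁, hj₁ω⟩ := hne
  have hωtr : Transcendental K ω := hj₁ω ▸ htrj j₁ hj₁
  -- a non-zero coefficient of `R_ω`
  obtain ⟨m₀, hm₀⟩ := Polynomial.support_nonempty.2 hf0
  have hfm₀ : f.coeff m₀ ≠ 0 := Polynomial.mem_support_iff.1 hm₀
  have hgm₀ : g m₀ ≠ 0 := by
    intro h0
    apply hfm₀
    have h1 := hg m₀
    rw [h0, map_zero] at h1
    exact_mod_cast h1.symm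
  obtain ⟨ℓ, hℓ⟩ := Polynomial.support_nonempty.2 hgm₀
  have hgℓ : (g m₀).coeff ℓ ≠ 0 := Polynomial.mem_support_iff.1 hℓ
  set hpoly : Polynomial K := ∑ m ∈ f.support, Polynomial.C ((g m).coeff ℓ) * Polynomial.X ^ m with hhpoly
  have hhne : hpoly ≠ 0 := by
    intro h0
    apply hgℓ
    have hc := congrArg (fun q : Polynomial K => q.coeff m₀) h0
    simp only [hhpoly, Polynomial.finsetSum_coeff, Polynomial.coeff_C_mul_X_pow, Polynomial.coeff_zero,
      Finset.sum_ite_eq, hm₀, if_true] at hc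
    exact hc
  have haeval : Polynomial.aeval ω hpoly ≠ 0 := fun h => hωtr ⟨hpoly, hhne, h⟩
  set Rω : Polynomial ℂ := ∑ m ∈ f.support, ω ^ m • (g m).map (algebraMap K ℂ) with hRω
  have hRcoeff : Rω.coeff ℓ = Polynomial.aeval ω hpoly := by
    simp only [hRω, hhpoly, Polynomial.finsetSum_coeff, Polynomial.coeff_smul, Polynomial.coeff_map, smul_eq_mul,
      map_sum, map_mul, map_pow, Polynomial.aeval_C, Polynomial.aeval_X]
    exact Finset.sum_congr rfl fun m _ => mul_comm _ _
  have hRne : Rω ≠ 0 := fun h => haeval (by rw [← hRcoeff, h, Polynomial.coeff_zero])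
  -- the fibre injects into the roots of `R_ω`
  refine Set.Finite.of_finite_image ((Finset.finite_toSet Rω.roots.toFinset).subset ?_) (hinj.mono fun j hj => hj.1)
  rintro _ ⟨j, ⟨hj, hjω⟩, rfl⟩
  rw [Finset.mem_coe, Multiset.mem_toFinset, Polynomial.mem_roots hRne, Polynomial.IsRoot.def]
  have h := hGj j hj
  rw [hjω] at h
  simp only [hRω, Polynomial.eval_finsetSum, Polynomial.eval_smul, Polynomial.eval_map, smul_eq_mul]
  rw [← h]
  refine Finset.sum_congr rfl fun m _ => ?_
  rw [← Polynomial.aeval_def, mul_comm]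

end Summit.Schanuel.Schanuel.Cruxes.MinimalCounterexampleInAcl.KernelArithmeticSelection

end
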